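import Summits.Ventures.PercRepro.C041TriDomDominationAnchored
import Summits.Ventures.PercRepro.C041TriDomMixturePrinciple

/-!
# ROW C-041 — COROLLARIES OF THE CLASS DOMINATION: THE FACTOR THREE, TRIANGLES ON THE MARKS, THE WEIGHTED FORMS
(p6, gen 44; P6-TWOEXIT-LEAN.md §53 ADDENDUM 15, continued 3)

* THE FACTOR THREE (`card_cycCrossed_le_three_mul`, `card_ancCrossed_le_three_mul`): on every host and every up-set
  `V`, the crossed classes of either orientation are at most `3 · #{V ∧ (⊤,⊥)}` — the sum of the three class bounds;
  CONJECTURE (STOCHASTIC DOMINATION) says the constant is `1`.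
* A TRIANGLE OF EDGES ON THE MARKS empties every crossed class (`not_cycCrossed_of_triangle`,
  `not_ancCrossed_of_triangle`: the edge `x–z` must be blue, `x–y` red, and `y–z` can be neither), so both
  conjectures hold there (`cycDomination_of_triangle`, `ancDomination_of_triangle`) — whatever else the host contains.
* THE WEIGHTED FORMS on separable hosts (`cycDomination_weighted_of_separable`, `ancDomination_weighted_of_separable`):
  `P_w(V ∧ A) ≤ P_w(V ∧ (⊤,⊥))` for all `w e ∈ [½, 1]` and every up-set `V`, by THE MIXTURE PRINCIPLE; and the
  anchored up-set form gives its weighted form in general (`ancDomination_weighted`).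
-/

namespace PercRepro

namespace ZoneZ

namespace MultiExit

open ZoneData Finset

variable {V₁ E₁ U₁ U₂ : Type} (Z₁ : ZoneData V₁ E₁ U₁ U₂) (u u' a₁ : V₁)

variable [Fintype E₁] [DecidableEq E₁]

/-! ## The factor three -/

open Classical in
/-- The crossed count is the sum of the three class counts (the classes are disjoint). -/
theorem card_cycCrossed_eq {V : (E₁ → Bool) → Prop} :
    (univ.filter fun ω : E₁ → Bool => V ω ∧ CycCrossed Z₁ a₁ u u' ω).card =
      (univ.filter fun ω : E₁ → Bool => V ω ∧ (rsig Z₁ u u' a₁ (fun _ => EStat.free) ω = (true, false, false) ∧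
        bsig Z₁ u u' a₁ (fun _ => EStat.free) ω = (false, true, false))).card
      + (univ.filter fun ω : E₁ → Bool => V ω ∧ (rsig Z₁ u u' a₁ (fun _ => EStat.free) ω = (false, true, false) ∧
        bsig Z₁ u u' a₁ (fun _ => EStat.free) ω = (false, false, true))).card
      + (univ.filter fun ω : E₁ → Bool => V ω ∧ (rsig Z₁ u u' a₁ (fun _ => EStat.free) ω = (false, false, true) ∧
        bsig Z₁ u u' a₁ (fun _ => EStat.free) ω = (true, false, false))).card := by
  rw [Finset.card_filter, Finset.card_filter, Finset.card_filter, Finset.card_filter, ← Finset.sum_add_distrib,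
    ← Finset.sum_add_distrib]
  refine Finset.sum_congr rfl fun ω _ => ?_
  unfold CycCrossed
  by_cases hV : V ω
  · simp only [hV, true_and]
    by_cases h1 : rsig Z₁ u u' a₁ (fun _ => EStat.free) ω = (true, false, false) ∧
        bsig Z₁ u u' a₁ (fun _ => EStat.free) ω = (false, true, false)
    · have h2 : ¬ (rsig Z₁ u u' a₁ (fun _ => EStat.free) ω = (false, true, false) ∧
          bsig Z₁ u u' a₁ (fun _ => EStat.free) ω = (false, false, true)) := fun h => by
        rw [h1.1] at h; exact absurd h.1 (by decide)
      have h3 : ¬ (rsig Z₁ u u' a₁ (fun _ => EStat.free) ω = (false, false, true) ∧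
          bsig Z₁ u u' a₁ (fun _ => EStat.free) ω = (true, false, false)) := fun h => by
        rw [h1.1] at h; exact absurd h.1 (by decide)
      simp [h1]
    · by_cases h2 : rsig Z₁ u u' a₁ (fun _ => EStat.free) ω = (false, true, false) ∧
          bsig Z₁ u u' a₁ (fun _ => EStat.free) ω = (false, false, true)
      · have h3 : ¬ (rsig Z₁ u u' a₁ (fun _ => EStat.free) ω = (false, false, true) ∧
            bsig Z₁ u u' a₁ (fun _ => EStat.free) ω = (true, false, false)) := fun h => by
          rw [h2.1] at h; exact absurd h.1 (by decide)
        simp [h2]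
      · by_cases h3 : rsig Z₁ u u' a₁ (fun _ => EStat.free) ω = (false, false, true) ∧
            bsig Z₁ u u' a₁ (fun _ => EStat.free) ω = (true, false, false)
        · simp [h3]
        · simp [h1, h2, h3]
  · simp [hV]

open Classical in
/-- **THE FACTOR THREE (cyclic)**: the crossed classes are at most three times `(⊤,⊥)` on every up-set. -/
theorem card_cycCrossed_le_three_mul {V : (E₁ → Bool) → Prop} (hV : UpSet V) :
    (univ.filter fun ω : E₁ → Bool => V ω ∧ CycCrossed Z₁ a₁ u u' ω).card ≤
      3 * (univ.filter fun ω : E₁ → Bool => V ω ∧ TopBot Z₁ a₁ u u' ω).card := by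
  rw [card_cycCrossed_eq]
  have h1 := class12_le_topBot Z₁ u u' a₁ hV
  have h2 := class23_le_topBot Z₁ u u' a₁ hV
  have h3 := class31_le_topBot Z₁ u u' a₁ hV
  omega

open Classical in
/-- The anchored crossed count is the sum of its three class counts. -/
theorem card_ancCrossed_eq {V : (E₁ → Bool) → Prop} :
    (univ.filter fun ω : E₁ → Bool => V ω ∧ AncCrossed Z₁ u u' a₁ ω).card =
      (univ.filter fun ω : E₁ → Bool => V ω ∧ (rsig Z₁ u u' a₁ (fun _ => EStat.free) ω = (true, false, false) ∧
        bsig Z₁ u u' a₁ (fun _ => EStat.free) ω = (false, true, false))).card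
      + (univ.filter fun ω : E₁ → Bool => V ω ∧ (rsig Z₁ u u' a₁ (fun _ => EStat.free) ω = (false, true, false) ∧
        bsig Z₁ u u' a₁ (fun _ => EStat.free) ω = (false, false, true))).card
      + (univ.filter fun ω : E₁ → Bool => V ω ∧ (rsig Z₁ u u' a₁ (fun _ => EStat.free) ω = (true, false, false) ∧
        bsig Z₁ u u' a₁ (fun _ => EStat.free) ω = (false, false, true))).card := by
  rw [Finset.card_filter, Finset.card_filter, Finset.card_filter, Finset.card_filter, ← Finset.sum_add_distrib,
    ← Finset.sum_add_distrib]
  refine Finset.sum_congr rfl fun ω _ => ?_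
  unfold AncCrossed
  by_cases hV : V ω
  · simp only [hV, true_and]
    by_cases h1 : rsig Z₁ u u' a₁ (fun _ => EStat.free) ω = (true, false, false) ∧
        bsig Z₁ u u' a₁ (fun _ => EStat.free) ω = (false, true, false)
    · have h2 : ¬ (rsig Z₁ u u' a₁ (fun _ => EStat.free) ω = (false, true, false) ∧
          bsig Z₁ u u' a₁ (fun _ => EStat.free) ω = (false, false, true)) := fun h => by
        rw [h1.1] at h; exact absurd h.1 (by decide)
      have h3 : ¬ (rsig Z₁ u u' a₁ (fun _ => EStat.free) ω = (true, false, false) ∧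
          bsig Z₁ u u' a₁ (fun _ => EStat.free) ω = (false, false, true)) := fun h => by
        rw [h1.2] at h; exact absurd h.2 (by decide)
      simp [h1]
    · by_cases h2 : rsig Z₁ u u' a₁ (fun _ => EStat.free) ω = (false, true, false) ∧
          bsig Z₁ u u' a₁ (fun _ => EStat.free) ω = (false, false, true)
      · have h3 : ¬ (rsig Z₁ u u' a₁ (fun _ => EStat.free) ω = (true, false, false) ∧
            bsig Z₁ u u' a₁ (fun _ => EStat.free) ω = (false, false, true)) := fun h => by
          rw [h2.1] at h; exact absurd h.1 (by decide)
        simp [h2]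
      · by_cases h3 : rsig Z₁ u u' a₁ (fun _ => EStat.free) ω = (true, false, false) ∧
            bsig Z₁ u u' a₁ (fun _ => EStat.free) ω = (false, false, true)
        · simp [h3]
        · simp [h1, h2, h3]
  · simp [hV]

open Classical in
/-- **THE FACTOR THREE (anchored)**. -/
theorem card_ancCrossed_le_three_mul {V : (E₁ → Bool) → Prop} (hV : UpSet V) :
    (univ.filter fun ω : E₁ → Bool => V ω ∧ AncCrossed Z₁ u u' a₁ ω).card ≤
      3 * (univ.filter fun ω : E₁ → Bool => V ω ∧ TopBot Z₁ a₁ u u' ω).card := by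
  rw [card_ancCrossed_eq]
  have h1 := class12_le_topBot Z₁ u u' a₁ hV
  have h2 := class23_le_topBot Z₁ u u' a₁ hV
  have h3 := class13_le_topBot Z₁ u u' a₁ hV
  omega

/-! ## A triangle of edges on the marks -/

omit [Fintype E₁] [DecidableEq E₁] in
/-- A red edge joining two vertices red-connects them (all-free status). -/
theorem RdS_of_joins {ω : E₁ → Bool} {e : E₁} {p q : V₁} (hj : Z₁.Joins e p q) (he : ω e = true) :
    RdS Z₁ (fun _ => EStat.free) ω p q := by
  unfold RdS
  rw [mem_reach_singleton]
  exact Relation.ReflTransGen.single ⟨e, hj, Or.inr ⟨rfl, he⟩⟩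

omit [Fintype E₁] [DecidableEq E₁] in
/-- A blue edge joining two vertices blue-connects them (all-free status). -/
theorem MgS_of_joins {ω : E₁ → Bool} {e : E₁} {p q : V₁} (hj : Z₁.Joins e p q) (he : ω e = false) :
    MgS Z₁ (fun _ => EStat.free) ω p q := by
  unfold MgS
  rw [mem_reach_singleton]
  exact Relation.ReflTransGen.single ⟨e, hj, Or.inr ⟨rfl, he⟩⟩

omit [Fintype E₁] [DecidableEq E₁] in
/-- With edges `x–y`, `x–z`, `y–z` on the marks no colouring lies in a crossed class of either orientation: in
each class one pair is connected in red only and another in blue only, so the third edge can be neither colour. -/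
theorem not_crossed_of_triangle {f₁ f₂ f₃ : E₁} (h1 : Z₁.Joins f₁ a₁ u) (h2 : Z₁.Joins f₂ a₁ u')
    (h3 : Z₁.Joins f₃ u u') (ω : E₁ → Bool) :
    ¬ (rsig Z₁ u u' a₁ (fun _ => EStat.free) ω = (true, false, false) ∧
        bsig Z₁ u u' a₁ (fun _ => EStat.free) ω = (false, true, false)) ∧
    ¬ (rsig Z₁ u u' a₁ (fun _ => EStat.free) ω = (false, true, false) ∧
        bsig Z₁ u u' a₁ (fun _ => EStat.free) ω = (false, false, true)) ∧
    ¬ (rsig Z₁ u u' a₁ (fun _ => EStat.free) ω = (false, false, true) ∧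
        bsig Z₁ u u' a₁ (fun _ => EStat.free) ω = (true, false, false)) ∧
    ¬ (rsig Z₁ u u' a₁ (fun _ => EStat.free) ω = (true, false, false) ∧
        bsig Z₁ u u' a₁ (fun _ => EStat.free) ω = (false, false, true)) := by
  -- each edge is red or blue: the connectivity it creates
  have e1 : RdS Z₁ (fun _ => EStat.free) ω a₁ u ∨ MgS Z₁ (fun _ => EStat.free) ω a₁ u := by
    cases h : ω f₁
    · exact Or.inr (MgS_of_joins Z₁ h1 h)
    · exact Or.inl (RdS_of_joins Z₁ h1 h)
  have e2 : RdS Z₁ (fun _ => EStat.free) ω a₁ u' ∨ MgS Z₁ (fun _ => EStat.free) ω a₁ u' := by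
    cases h : ω f₂
    · exact Or.inr (MgS_of_joins Z₁ h2 h)
    · exact Or.inl (RdS_of_joins Z₁ h2 h)
  have e3 : RdS Z₁ (fun _ => EStat.free) ω u u' ∨ MgS Z₁ (fun _ => EStat.free) ω u u' := by
    cases h : ω f₃
    · exact Or.inr (MgS_of_joins Z₁ h3 h)
    · exact Or.inl (RdS_of_joins Z₁ h3 h)
  refine ⟨fun ⟨hr, hb⟩ => ?_, fun ⟨hr, hb⟩ => ?_, fun ⟨hr, hb⟩ => ?_, fun ⟨hr, hb⟩ => ?_⟩ <;>
    rw [rsig_eq_iff] at hr <;> rw [bsig_eq_iff] at hb <;>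
    simp only [iff_true, Bool.false_eq_true, iff_false] at hr hb
  · rcases e3 with h | h
    · exact hr.2.2 h
    · exact hb.2.2 h
  · rcases e1 with h | h
    · exact hr.1 h
    · exact hb.1 h
  · rcases e2 with h | h
    · exact hr.2.1 h
    · exact hb.2.1 h
  · rcases e2 with h | h
    · exact hr.2.1 h
    · exact hb.2.1 h

omit [Fintype E₁] [DecidableEq E₁] in
/-- A triangle of edges on the marks empties the cyclic crossed classes. -/
theorem not_cycCrossed_of_triangle {f₁ f₂ f₃ : E₁} (h1 : Z₁.Joins f₁ a₁ u) (h2 : Z₁.Joins f₂ a₁ u')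
    (h3 : Z₁.Joins f₃ u u') (ω : E₁ → Bool) : ¬ CycCrossed Z₁ a₁ u u' ω := by
  obtain ⟨n1, n2, n3, _⟩ := not_crossed_of_triangle Z₁ u u' a₁ h1 h2 h3 ω
  rintro (h | h | h)
  · exact n1 h
  · exact n2 h
  · exact n3 h

omit [Fintype E₁] [DecidableEq E₁] in
/-- A triangle of edges on the marks empties the anchored crossed classes. -/
theorem not_ancCrossed_of_triangle {f₁ f₂ f₃ : E₁} (h1 : Z₁.Joins f₁ a₁ u) (h2 : Z₁.Joins f₂ a₁ u')
    (h3 : Z₁.Joins f₃ u u') (ω : E₁ → Bool) : ¬ AncCrossed Z₁ u u' a₁ ω := by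
  obtain ⟨n1, n2, _, n4⟩ := not_crossed_of_triangle Z₁ u u' a₁ h1 h2 h3 ω
  rintro (h | h | h)
  · exact n1 h
  · exact n2 h
  · exact n4 h

open Classical in
/-- **CONJECTURE (STOCHASTIC DOMINATION) HOLDS ON EVERY HOST WITH A TRIANGLE ON ITS MARKS** (cyclic). -/
theorem cycDomination_of_triangle {f₁ f₂ f₃ : E₁} (h1 : Z₁.Joins f₁ a₁ u) (h2 : Z₁.Joins f₂ a₁ u')
    (h3 : Z₁.Joins f₃ u u') : CycDomination Z₁ a₁ u u' := by
  intro V _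
  refine le_trans (card_cycCrossed_le_of_two_empty Z₁ u u' a₁ (fun _ => False) fun ω _ hc =>
    not_cycCrossed_of_triangle Z₁ u u' a₁ h1 h2 h3 ω hc) ?_
  simp

open Classical in
/-- **CONJECTURE (STOCHASTIC DOMINATION) HOLDS ON EVERY HOST WITH A TRIANGLE ON ITS MARKS** (anchored). -/
theorem ancDomination_of_triangle {f₁ f₂ f₃ : E₁} (h1 : Z₁.Joins f₁ a₁ u) (h2 : Z₁.Joins f₂ a₁ u')
    (h3 : Z₁.Joins f₃ u u') : AncDomination Z₁ u u' a₁ := by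
  intro V _
  refine le_trans (card_ancCrossed_le_of_two_empty Z₁ u u' a₁ (fun _ => False) fun ω _ hc =>
    not_ancCrossed_of_triangle Z₁ u u' a₁ h1 h2 h3 ω hc) ?_
  simp

/-! ## The weighted forms -/

open Classical in
/-- The anchored up-set form gives its weighted form at every edge probability `≥ ½`. -/
theorem ancDomination_weighted (h : AncDomination Z₁ u u' a₁) {V : (E₁ → Bool) → Prop} (hV : UpSet V)
    (w : E₁ → ℚ) (hw : ∀ e, 1 / 2 ≤ w e ∧ w e ≤ 1) :
    ∑ ω : E₁ → Bool, cwt w ω * (if V ω ∧ AncCrossed Z₁ u u' a₁ ω then 1 else 0) ≤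
      ∑ ω : E₁ → Bool, cwt w ω * (if V ω ∧ TopBot Z₁ a₁ u u' ω then 1 else 0) := by
  have h' := sum_cwt_nonneg_of_forced
    (fun ω => (if V ω ∧ TopBot Z₁ a₁ u u' ω then 1 else 0) - (if V ω ∧ AncCrossed Z₁ u u' a₁ ω then 1 else 0))
    (fun S => by
      have hc := h _ (upSet_inter_forced hV S)
      have hR : ∑ ω : E₁ → Bool, (if (∀ e ∈ S, ω e = true) then
            (if V ω ∧ TopBot Z₁ a₁ u u' ω then (1 : ℚ) else 0) else 0) =
          ((univ.filter fun ω : E₁ → Bool => (V ω ∧ ∀ e ∈ S, ω e = true) ∧ TopBot Z₁ a₁ u u' ω).card : ℚ) := by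
        rw [Finset.card_filter]
        push_cast
        refine Finset.sum_congr rfl fun ω _ => ?_
        by_cases hS : ∀ e ∈ S, ω e = true <;> by_cases hV' : V ω <;> by_cases hT : TopBot Z₁ a₁ u u' ω <;>
          simp [hS, hV', hT]
      have hB : ∑ ω : E₁ → Bool, (if (∀ e ∈ S, ω e = true) then
            (if V ω ∧ AncCrossed Z₁ u u' a₁ ω then (1 : ℚ) else 0) else 0) =
          ((univ.filter fun ω : E₁ → Bool => (V ω ∧ ∀ e ∈ S, ω e = true) ∧ AncCrossed Z₁ u u' a₁ ω).card : ℚ) := by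
        rw [Finset.card_filter]
        push_cast
        refine Finset.sum_congr rfl fun ω _ => ?_
        by_cases hS : ∀ e ∈ S, ω e = true <;> by_cases hV' : V ω <;> by_cases hA : AncCrossed Z₁ u u' a₁ ω <;>
          simp [hS, hV', hA]
      have hsplit : ∑ ω : E₁ → Bool, (if (∀ e ∈ S, ω e = true) then
          ((if V ω ∧ TopBot Z₁ a₁ u u' ω then (1 : ℚ) else 0)
            - (if V ω ∧ AncCrossed Z₁ u u' a₁ ω then 1 else 0)) else 0) =
          ∑ ω : E₁ → Bool, (if (∀ e ∈ S, ω e = true) then (if V ω ∧ TopBot Z₁ a₁ u u' ω then (1 : ℚ) else 0) else 0)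
            - ∑ ω : E₁ → Bool, (if (∀ e ∈ S, ω e = true) then
                (if V ω ∧ AncCrossed Z₁ u u' a₁ ω then (1 : ℚ) else 0) else 0) := by
        rw [← Finset.sum_sub_distrib]
        refine Finset.sum_congr rfl fun ω _ => ?_
        by_cases hS : ∀ e ∈ S, ω e = true
        · simp only [if_pos hS]
        · simp only [if_neg hS, sub_zero]
      rw [hsplit, hR, hB, sub_nonneg]
      have hc2 := (Nat.cast_le (α := ℚ)).mpr hc
      convert hc2 <;> rfl) w hw
  simp only [mul_sub, Finset.sum_sub_distrib, sub_nonneg] at h'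
  exact h'

open Classical in
/-- **THE WEIGHTED DOMINATION ON SEPARABLE HOSTS (cyclic)**: for all `w e ∈ [½, 1]` and every up-set `V`. -/
theorem cycDomination_weighted_of_separable (h : SeparableS Z₁ u u' a₁ (fun _ => EStat.free))
    {V : (E₁ → Bool) → Prop} (hV : UpSet V) (w : E₁ → ℚ) (hw : ∀ e, 1 / 2 ≤ w e ∧ w e ≤ 1) :
    ∑ ω : E₁ → Bool, cwt w ω * (if V ω ∧ CycCrossed Z₁ a₁ u u' ω then 1 else 0) ≤
      ∑ ω : E₁ → Bool, cwt w ω * (if V ω ∧ TopBot Z₁ a₁ u u' ω then 1 else 0) :=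
  cycDomination_weighted Z₁ (x := a₁) (y := u) (z := u') (cycDomination_of_separable Z₁ u u' a₁ h) hV w hw

open Classical in
/-- **THE WEIGHTED DOMINATION ON SEPARABLE HOSTS (anchored)**. -/
theorem ancDomination_weighted_of_separable (h : SeparableS Z₁ u u' a₁ (fun _ => EStat.free))
    {V : (E₁ → Bool) → Prop} (hV : UpSet V) (w : E₁ → ℚ) (hw : ∀ e, 1 / 2 ≤ w e ∧ w e ≤ 1) :
    ∑ ω : E₁ → Bool, cwt w ω * (if V ω ∧ AncCrossed Z₁ u u' a₁ ω then 1 else 0) ≤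
      ∑ ω : E₁ → Bool, cwt w ω * (if V ω ∧ TopBot Z₁ a₁ u u' ω then 1 else 0) :=
  ancDomination_weighted Z₁ u u' a₁ (ancDomination_of_separable Z₁ u u' a₁ h) hV w hw

end MultiExit

end ZoneZ

end PercRepro
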